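import Summits.KontsevichZagierPeriods.KontsevichZagierPeriods.Theorems.SoloInformedTelescopeReps
import HarnessLib
import HarnessLib.Audit

/-!
# SoloInformed — the weight-3 Möbius telescope inside the KZ rules (THEOREM XVI.2, k = 1)

Solo programme `solo-KontsevichZagierPeriods-informed`, session s45 (PART XVI, the mixed Tate
sector). Coordinates `y = x₀`, `u = x₁`, `w = x₂` on `O = (0,1)³`; representations from
`SoloInformedTelescopeReps`. **Main theorem** `soloInformed_telescope`:

  `[D₁ = O ∩ {w < u}, 1/((1−yu)(1−w))] − [O, 1/((1−yu)(1−yuw))] ∈ KZ.relations`,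

the regularisation step `𝕁(Q = y)` of the Kaneko–Yamamoto integral–series identity realised by
the naive rules only:

* (1b) `R₁ = A + B` with `A = R₂|_{D₁}`, `B = [D₁, w/((1−yuw)(1−w))]`
  (`1/((1−yu)(1−w)) = 1/((1−yu)(1−yuw)) + w/((1−yuw)(1−w))`);
* (1a) `R₂ = A + C`, `C = R₂|_{D₂}`, the wall `{u = w}` being null;
* (2)  `B ≡ R♯ = [O ∩ {w² < u < w}, 1/((1−yu)(1−w))]` by `u' = uw`;
* (2)  `V = [O, w/((1−yvw)(1−yvw²))] ≡ C` by `u = vw`;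
* (2)  `V ≡ R♯` by the **Möbius substitution**
  `σ(y,v,w) = w(w + v(1−w−yw²))/(1 − yw²v)`, `∂σ/∂v = w(1−w)(1−yw²)/(1−yw²v)²`,
  `1 − yσ = (1−yw²)(1−ywv)/(1−yw²v)`, which maps `O` onto `O ∩ {w² < u < w}` fibrewise.

No Stokes/Newton–Leibniz move and no limiting process is used: the "regularised" relation is an
identity of absolutely convergent integrals obtained by re-fibering. Iterating the step down a
Kaneko–Yamamoto zig-zag gives every integral–series relation with `k = (1)` (paper THM XVI.2);
this file is the kernel certificate of the step.

References: M. Kontsevich, D. Zagier, *Periods* (2001), §1.2 [KontsevichZagier2001];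
M. Kaneko, S. Yamamoto, *A new integral–series identity of multiple zeta values and
regularizations*, Selecta Math. 24 (2018), arXiv:1605.03117, Thm 1.1, §4.
-/

noncomputable section

open MeasureTheory Set MvPolynomial
open Literature.ModelTheory.ExponentialFields Literature.NumberTheory.Transcendental
open Literature.NumberTheory.Transcendental.KZ

namespace Summit.KontsevichZagierPeriods.KontsevichZagierPeriods.Theorems

/-! ## 1. Rule (1b): `R₁ = A + B` -/

/-- The partial-fraction identity behind the split `R₁ = A + B`. -/
theorem soloInformedTelF1_eq_S_add_G {x : Fin 3 → ℝ} (hx : x ∈ soloInformedOpenCube 3) :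
    soloInformedTelF1 x = soloInformedTelS x + soloInformedTelG x := by
  have ha := (soloInformed_one_sub_yu_pos hx).ne'
  have hb := (soloInformed_one_sub_yuw_pos hx).ne'
  have hc := (soloInformed_one_sub_w_pos hx).ne'
  simp only [soloInformedTelF1, soloInformedTelS, soloInformedTelG]
  field_simp
  ring

/-- **(1b)** `[R₁] − [A] − [B] ∈ relations`. -/
theorem soloInformed_tel_move1 :
    of soloInformedTelR1 - of soloInformedTelA - of soloInformedTelB ∈ relations :=
  integrandAddRel_subset_relations ⟨3, soloInformedTelR1, soloInformedTelA, soloInformedTelB, rfl,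
    rfl, fun _ hx => soloInformedTelF1_eq_S_add_G hx.1, rfl⟩

/-! ## 2. Rule (1a): `R₂ = A + C` (the wall `{u = w}` is null) -/

/-- The two pieces of `R₂`. -/
def soloInformedTelPieces : Fin 2 → IntegralRep 3 := ![soloInformedTelA, soloInformedTelC]

/-- Auxiliary (weight-3 telescope): `soloInformedTelPieces_zero`. -/
@[simp] theorem soloInformedTelPieces_zero : soloInformedTelPieces 0 = soloInformedTelA := rfl
/-- Auxiliary (weight-3 telescope): `soloInformedTelPieces_one`. -/
@[simp] theorem soloInformedTelPieces_one : soloInformedTelPieces 1 = soloInformedTelC := rfl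

/-- The wall `O \ (D₁ ∪ D₂) ⊆ {u = w}` is null. -/
theorem soloInformed_tel_wall_null :
    volume (soloInformedOpenCube 3 \ ⋃ i ∈ (Finset.univ : Finset (Fin 2)),
      (soloInformedTelPieces i).domain) = 0 := by
  refine soloInformed_volume_eq_zero_of_subset_zeroSet3 (X 1 - X 2) (fun h => ?_) fun x hx => ?_
  · have h1 := congr_arg (MvPolynomial.eval (fun i : Fin 3 => if i = 1 then (1 : ℚ) else 0)) h
    simp at h1
  · have hO := hx.1
    have hnot := hx.2
    simp only [Finset.mem_univ, iUnion_true, mem_iUnion, not_exists] at hnot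
    have h0 : ¬ x 2 < x 1 := fun hlt => hnot 0 ⟨hO, hlt⟩
    have h1 : ¬ x 1 < x 2 := fun hlt => hnot 1 ⟨hO, hlt⟩
    have heq : x 1 = x 2 := le_antisymm (not_lt.1 h0) (not_lt.1 h1)
    simp [heq]

/-- **(1a)** `[R₂] − ([A] + [C]) ∈ relations`. -/
theorem soloInformed_tel_move2 :
    of soloInformedTelR2 - (of soloInformedTelA + of soloInformedTelC) ∈ relations := by
  have h := of_sub_sum_of_mem_relations_of_subset (Finset.univ : Finset (Fin 2)) soloInformedTelR2
    soloInformedTelPieces (fun i _ => by fin_cases i <;> exact inter_subset_left)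
    (fun i _ => by fin_cases i <;> exact fun _ _ => rfl) soloInformed_tel_wall_null
    (fun i _ j _ hij => by
      fin_cases i <;> fin_cases j
      · exact (hij rfl).elim
      · exact disjoint_left.2 fun x (hx : x ∈ soloInformedTelD1) (hx' : x ∈ soloInformedTelD2) =>
          lt_asymm (show x 2 < x 1 from hx.2) (show x 1 < x 2 from hx'.2)
      · exact disjoint_left.2 fun x (hx : x ∈ soloInformedTelD2) (hx' : x ∈ soloInformedTelD1) =>
          lt_asymm (show x 1 < x 2 from hx.2) (show x 2 < x 1 from hx'.2)
      · exact (hij rfl).elim)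
  simpa [Fin.sum_univ_two] using h

/-! ## 3. Rule (2) along `Φ(y,u,w) = (y,uw,w)`: `B ≡ R♯` and `V ≡ C` -/

/-- **(2)** `[B] − [R♯] ∈ relations` (`u' = uw` maps `D₁` onto `D♯`, Jacobian `w`). -/
theorem soloInformed_tel_move3 : of soloInformedTelB - of soloInformedTelRs ∈ relations :=
  soloInformed_of_sub_of_mem_relations_polyMapCLM soloInformedTelPhiPoly soloInformedTelB
    soloInformedTelRs (soloInformed_injOn_telPhi.mono soloInformedTelD1_subset)
    soloInformed_image_telPhi_D1.symm fun x hx => by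
      show soloInformedTelG x = soloInformedTelF1 (soloInformedTelPhi x) * _
      rw [soloInformed_det_telPhi, abs_of_pos (hx.1 2).1, soloInformedTelF1_phi]

/-- **(2)** `[V] − [C] ∈ relations` (`u = vw` maps `O` onto `D₂`, Jacobian `w`). -/
theorem soloInformed_tel_move4 : of soloInformedTelV - of soloInformedTelC ∈ relations :=
  soloInformed_of_sub_of_mem_relations_polyMapCLM soloInformedTelPhiPoly soloInformedTelV
    soloInformedTelC soloInformed_injOn_telPhi soloInformed_image_telPhi_cube.symm fun x hx => by
      show soloInformedTelFV x = soloInformedTelS (soloInformedTelPhi x) * _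
      rw [soloInformed_det_telPhi, abs_of_pos (hx 2).1, soloInformedTelS_phi]

/-! ## 4. Rule (2) along the Möbius substitution: `V ≡ R♯` -/

/-- Numerators of `Ψ(y,v,w) = (y, σ(y,v,w), w)`. -/
def soloInformedTelPsiNum : Fin 3 → MvPolynomial (Fin 3) ℚ :=
  ![X 0, X 2 * (X 2 + X 1 * (1 - X 2 - X 0 * X 2 * X 2)), X 2]

/-- Denominators of `Ψ`. -/
def soloInformedTelPsiDen : Fin 3 → MvPolynomial (Fin 3) ℚ := ![1, 1 - X 0 * X 1 * X 2 * X 2, 1]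

/-- `Ψ = (y, σ, w)` as a rational map with rational coefficients. -/
def soloInformedTelPsi : (Fin 3 → ℝ) → (Fin 3 → ℝ) :=
  soloInformedRatMap soloInformedTelPsiNum soloInformedTelPsiDen

/-- `σ(y,v,w) = w(w + v(1 − w − yw²))/(1 − yvw²)`. -/
def soloInformedTelSigma (x : Fin 3 → ℝ) : ℝ :=
  x 2 * (x 2 + x 1 * (1 - x 2 - x 0 * x 2 * x 2)) / (1 - x 0 * x 1 * x 2 * x 2)

/-- Auxiliary (weight-3 telescope): `soloInformedTelPsi_zero`. -/
@[simp] theorem soloInformedTelPsi_zero (x : Fin 3 → ℝ) : soloInformedTelPsi x 0 = x 0 := by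
  simp [soloInformedTelPsi, soloInformedTelPsiNum, soloInformedTelPsiDen]
/-- Auxiliary (weight-3 telescope): `soloInformedTelPsi_one`. -/
@[simp] theorem soloInformedTelPsi_one (x : Fin 3 → ℝ) :
    soloInformedTelPsi x 1 = soloInformedTelSigma x := by
  simp [soloInformedTelPsi, soloInformedTelPsiNum, soloInformedTelPsiDen, soloInformedTelSigma]
/-- Auxiliary (weight-3 telescope): `soloInformedTelPsi_two`. -/
@[simp] theorem soloInformedTelPsi_two (x : Fin 3 → ℝ) : soloInformedTelPsi x 2 = x 2 := by
  simp [soloInformedTelPsi, soloInformedTelPsiNum, soloInformedTelPsiDen]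

/-- The denominators of `Ψ` do not vanish on the cube. -/
theorem soloInformed_telPsiDen_ne (j : Fin 3) (x : Fin 3 → ℝ) (hx : x ∈ soloInformedOpenCube 3) :
    (aeval x (soloInformedTelPsiDen j) : ℝ) ≠ 0 := by
  have h := (soloInformed_one_sub_yuww_pos hx).ne'
  fin_cases j
  · simp [soloInformedTelPsiDen]
  · simpa [soloInformedTelPsiDen] using h
  · simp [soloInformedTelPsiDen]

/-- **Jacobian of `Ψ`**: `det J_Ψ = w(1−w)(1−yw²)/(1−yvw²)²`. -/
theorem soloInformed_det_telPsi (x : Fin 3 → ℝ) :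
    (soloInformedRatJacCLM soloInformedTelPsiNum soloInformedTelPsiDen x).det =
      x 2 * (1 - x 2) * (1 - x 0 * x 2 * x 2) / (1 - x 0 * x 1 * x 2 * x 2) ^ 2 := by
  rw [soloInformed_det_ratJacCLM, Matrix.det_fin_three]
  simp [Matrix.of_apply, soloInformedRatJacEntry, soloInformedTelPsiNum, soloInformedTelPsiDen,
    pderiv_X]
  field_simp
  ring

section sigma
variable {x : Fin 3 → ℝ}

/-- `1 − yw² > 0` on the cube. -/
theorem soloInformed_tel_yww_pos (hx : x ∈ soloInformedOpenCube 3) : 0 < 1 - x 0 * x 2 * x 2 := by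
  have h0 := hx 0; have h2 := hx 2
  nlinarith [mul_pos h0.1 h2.1, mul_pos (mul_pos h0.1 h2.1) h2.1]

/-- `σ − w² = vw(1−w)(1−yw²)/(1−yvw²)`. -/
theorem soloInformed_telSigma_sub_sq (hx : x ∈ soloInformedOpenCube 3) :
    soloInformedTelSigma x - x 2 ^ 2 =
      x 1 * x 2 * (1 - x 2) * (1 - x 0 * x 2 * x 2) / (1 - x 0 * x 1 * x 2 * x 2) := by
  unfold soloInformedTelSigma
  set d := 1 - x 0 * x 1 * x 2 * x 2 with hd_def
  have hd : d ≠ 0 := hd_def ▸ (soloInformed_one_sub_yuww_pos hx).ne'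
  field_simp
  rw [hd_def]; ring

/-- `w − σ = w(1−v)(1−w)/(1−yvw²)`. -/
theorem soloInformed_sub_telSigma (hx : x ∈ soloInformedOpenCube 3) :
    x 2 - soloInformedTelSigma x = x 2 * (1 - x 1) * (1 - x 2) / (1 - x 0 * x 1 * x 2 * x 2) := by
  unfold soloInformedTelSigma
  set d := 1 - x 0 * x 1 * x 2 * x 2 with hd_def
  have hd : d ≠ 0 := hd_def ▸ (soloInformed_one_sub_yuww_pos hx).ne'
  field_simp
  rw [hd_def]; ring

/-- `1 − yσ = (1−yw²)(1−yvw)/(1−yvw²)`. -/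
theorem soloInformed_one_sub_y_telSigma (hx : x ∈ soloInformedOpenCube 3) :
    1 - x 0 * soloInformedTelSigma x =
      (1 - x 0 * x 2 * x 2) * (1 - x 0 * x 1 * x 2) / (1 - x 0 * x 1 * x 2 * x 2) := by
  unfold soloInformedTelSigma
  set d := 1 - x 0 * x 1 * x 2 * x 2 with hd_def
  have hd : d ≠ 0 := hd_def ▸ (soloInformed_one_sub_yuww_pos hx).ne'
  field_simp
  rw [hd_def]; ring

/-- `Ψ` maps the cube into `D♯`. -/
theorem soloInformed_telPsi_mem (hx : x ∈ soloInformedOpenCube 3) :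
    soloInformedTelPsi x ∈ soloInformedTelDs := by
  have h0 := hx 0; have h1 := hx 1; have h2 := hx 2
  have hd := soloInformed_one_sub_yuww_pos hx
  have hK := soloInformed_tel_yww_pos hx
  have hlo : x 2 ^ 2 < soloInformedTelSigma x := by
    have := soloInformed_telSigma_sub_sq hx
    have hpos : 0 < x 1 * x 2 * (1 - x 2) * (1 - x 0 * x 2 * x 2) / (1 - x 0 * x 1 * x 2 * x 2) :=
      div_pos (mul_pos (mul_pos (mul_pos h1.1 h2.1) (by linarith)) hK) hd
    linarith
  have hhi : soloInformedTelSigma x < x 2 := by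
    have := soloInformed_sub_telSigma hx
    have hpos : 0 < x 2 * (1 - x 1) * (1 - x 2) / (1 - x 0 * x 1 * x 2 * x 2) :=
      div_pos (mul_pos (mul_pos h2.1 (by linarith)) (by linarith)) hd
    linarith
  refine ⟨fun j => ?_, ?_, ?_⟩
  · fin_cases j
    · simpa using h0
    · show 0 < soloInformedTelPsi x 1 ∧ soloInformedTelPsi x 1 < 1
      rw [soloInformedTelPsi_one]
      exact ⟨lt_trans (pow_pos h2.1 2) hlo, hhi.trans h2.2⟩
    · simpa using h2
  · show soloInformedTelPsi x 2 ^ 2 < soloInformedTelPsi x 1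
    simpa using hlo
  · show soloInformedTelPsi x 1 < soloInformedTelPsi x 2
    simpa using hhi

/-- The inverse of `v ↦ σ(y,v,w)`: `L(y,s,w) = (s − w²)/(w(1−w−yw²) + y·s·w²)`. -/
def soloInformedTelMobInv (x : Fin 3 → ℝ) : ℝ :=
  (x 1 - x 2 ^ 2) / (x 2 * (1 - x 2 - x 0 * x 2 * x 2) + x 0 * x 1 * x 2 * x 2)

/-- The denominator of `L` at `Ψ(x)`: `w(1−w−yw²) + yσw² = w(1−w)(1−yw²)/(1−yvw²)`. -/
theorem soloInformed_telMobInv_den (hx : x ∈ soloInformedOpenCube 3) :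
    x 2 * (1 - x 2 - x 0 * x 2 * x 2) + x 0 * soloInformedTelSigma x * x 2 * x 2 =
      x 2 * (1 - x 2) * (1 - x 0 * x 2 * x 2) / (1 - x 0 * x 1 * x 2 * x 2) := by
  unfold soloInformedTelSigma
  set d := 1 - x 0 * x 1 * x 2 * x 2 with hd_def
  have hd : d ≠ 0 := hd_def ▸ (soloInformed_one_sub_yuww_pos hx).ne'
  field_simp
  rw [hd_def]; ring

/-- **`L ∘ Ψ = v`** on the cube. -/
theorem soloInformed_telMobInv_psi (hx : x ∈ soloInformedOpenCube 3) :
    soloInformedTelMobInv (soloInformedTelPsi x) = x 1 := by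
  have h2 := hx 2
  have hd := soloInformed_one_sub_yuww_pos hx
  have hK := soloInformed_tel_yww_pos hx
  rw [soloInformedTelMobInv, soloInformedTelPsi_zero, soloInformedTelPsi_one, soloInformedTelPsi_two,
    soloInformed_telMobInv_den hx, soloInformed_telSigma_sub_sq hx]
  set a := 1 - x 0 * x 2 * x 2 with ha_def
  set d := 1 - x 0 * x 1 * x 2 * x 2 with hd_def
  have ha : a ≠ 0 := hK.ne'
  have hd' : d ≠ 0 := hd.ne'
  have hw : x 2 ≠ 0 := h2.1.ne'
  have hw' : 1 - x 2 ≠ 0 := by linarith [h2.2]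
  field_simp

/-- `Ψ` is injective on the cube. -/
theorem soloInformed_injOn_telPsi : InjOn soloInformedTelPsi (soloInformedOpenCube 3) := by
  intro x hx x' hx' h
  have h0 : x 0 = x' 0 := by simpa using congr_fun h 0
  have h2 : x 2 = x' 2 := by simpa using congr_fun h 2
  have h1 : x 1 = x' 1 := by
    rw [← soloInformed_telMobInv_psi hx, ← soloInformed_telMobInv_psi hx', h]
  ext j; fin_cases j
  · exact h0
  · exact h1
  · exact h2

end sigma

/-- **`Ψ(O) = D♯`.** Surjectivity: the preimage of `(y,s,w)` is `(y, L(y,s,w), w)`. -/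
theorem soloInformed_image_telPsi :
    soloInformedTelPsi '' soloInformedOpenCube 3 = soloInformedTelDs := by
  refine Subset.antisymm (by rintro _ ⟨x, hx, rfl⟩; exact soloInformed_telPsi_mem hx) fun x hx => ?_
  have h0 := hx.1 0; have h1 := hx.1 1; have h2 := hx.1 2
  have hsq : x 2 ^ 2 < x 1 := hx.2.1
  have hsw : x 1 < x 2 := hx.2.2
  -- the denominator of `L`
  set den := x 2 * (1 - x 2 - x 0 * x 2 * x 2) + x 0 * x 1 * x 2 * x 2 with hden
  have hden_pos : 0 < den := by
    have e : den = x 2 * (1 - x 2) - x 0 * x 2 * x 2 * (x 2 - x 1) := by rw [hden]; ring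
    rw [e]
    have hA : x 0 * x 2 * x 2 * (x 2 - x 1) < x 2 * x 2 * (x 2 - x 1) := by
      have := mul_pos (mul_pos h2.1 h2.1) (sub_pos.2 hsw)
      nlinarith
    nlinarith [mul_pos h2.1 (sub_pos.2 hsq)]
  set v := (x 1 - x 2 ^ 2) / den with hv
  have hv0 : 0 < v := div_pos (sub_pos.2 hsq) hden_pos
  have hv1 : v < 1 := by
    rw [hv, div_lt_one hden_pos]
    have : 0 < (x 2 - x 1) * (1 - x 0 * x 2 * x 2) :=
      mul_pos (sub_pos.2 hsw) (by nlinarith [mul_pos h0.1 h2.1, mul_pos (mul_pos h0.1 h2.1) h2.1])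
    nlinarith
  have hz : (![x 0, v, x 2] : Fin 3 → ℝ) ∈ soloInformedOpenCube 3 := fun j => by
    fin_cases j
    · simpa using h0
    · simpa using And.intro hv0 hv1
    · simpa using h2
  refine ⟨![x 0, v, x 2], hz, ?_⟩
  have hdz : (1 : ℝ) - x 0 * v * x 2 * x 2 ≠ 0 := by
    simpa using (soloInformed_one_sub_yuww_pos hz).ne'
  ext j; fin_cases j
  · simp
  · show soloInformedTelPsi ![x 0, v, x 2] 1 = x 1
    rw [soloInformedTelPsi_one, soloInformedTelSigma]
    simp only [Matrix.cons_val_zero, Matrix.cons_val_one, Matrix.cons_val_two, Matrix.tail_cons,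
      Matrix.head_cons]
    rw [div_eq_iff hdz, hv]
    field_simp
    rw [hden]; ring
  · simp

/-- **(2)** `[V] − [R♯] ∈ relations` by the Möbius substitution `Ψ`. -/
theorem soloInformed_tel_move5 : of soloInformedTelV - of soloInformedTelRs ∈ relations := by
  refine soloInformed_of_sub_of_mem_relations_ratMap soloInformedTelPsiNum soloInformedTelPsiDen
    soloInformedTelV soloInformedTelRs soloInformed_telPsiDen_ne soloInformed_injOn_telPsi
    soloInformed_image_telPsi.symm fun x hx => ?_
  have hx' : x ∈ soloInformedOpenCube 3 := hx
  have h2 := hx' 2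
  have hd := soloInformed_one_sub_yuww_pos hx'
  have hK := soloInformed_tel_yww_pos hx'
  have hdet : 0 < (soloInformedRatJacCLM soloInformedTelPsiNum soloInformedTelPsiDen x).det := by
    rw [soloInformed_det_telPsi]
    exact div_pos (mul_pos (mul_pos h2.1 (by linarith [h2.2])) hK) (pow_pos hd 2)
  rw [abs_of_pos hdet, soloInformed_det_telPsi]
  show soloInformedTelFV x = soloInformedTelF1 (soloInformedTelPsi x) * _
  rw [soloInformedTelF1, soloInformedTelPsi_zero, soloInformedTelPsi_one, soloInformedTelPsi_two,
    soloInformed_one_sub_y_telSigma hx', soloInformedTelFV]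
  set a := 1 - x 0 * x 2 * x 2 with ha_def
  set b := 1 - x 0 * x 1 * x 2 with hb_def
  set c := 1 - x 2 with hc_def
  set d := 1 - x 0 * x 1 * x 2 * x 2 with hd_def
  have ha : a ≠ 0 := hK.ne'
  have hb : b ≠ 0 := (soloInformed_one_sub_yuw_pos hx').ne'
  have hc : c ≠ 0 := (soloInformed_one_sub_w_pos hx').ne'
  have hd' : d ≠ 0 := hd.ne'
  field_simp

/-! ## 5. The telescope -/

/-- **THEOREM XVI.2 (k = 1), kernel form.**
`[O ∩ {w < u}, 1/((1−yu)(1−w))] − [O, 1/((1−yu)(1−yuw))] ∈ KZ.relations`: the regularisation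
step of the Kaneko–Yamamoto identity is a chain of five naive KZ moves. -/
theorem soloInformed_telescope : of soloInformedTelR1 - of soloInformedTelR2 ∈ relations := by
  have e : of soloInformedTelR1 - of soloInformedTelR2 =
      (of soloInformedTelR1 - of soloInformedTelA - of soloInformedTelB) +
        (of soloInformedTelB - of soloInformedTelRs) - (of soloInformedTelV - of soloInformedTelRs) +
        (of soloInformedTelV - of soloInformedTelC) -
        (of soloInformedTelR2 - (of soloInformedTelA + of soloInformedTelC)) := by abel
  rw [e]
  exact sub_mem (add_mem (sub_mem (add_mem soloInformed_tel_move1 soloInformed_tel_move3)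
    soloInformed_tel_move5) soloInformed_tel_move4) soloInformed_tel_move2

/-- The same statement as an equivalence of representations. -/
theorem soloInformed_telescope_equivalent : Equivalent soloInformedTelR1 soloInformedTelR2 :=
  soloInformed_telescope

end Summit.KontsevichZagierPeriods.KontsevichZagierPeriods.Theorems
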